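import Summits.CriticalPhenomena.PercolationContinuityZ3.Theorems.Transplant.SkelStepIVInputs
import Summits.CriticalPhenomena.PercolationContinuityZ3.Theorems.Transplant.KNLevelsStepIV
import HarnessLib

/-!
# L5.7 of the general node (`HOME/SHEAR-SCOPE.md` §3.9 / §3.10.3): Kozma–Nitzan's STEP IV input `hIV` at a candidate contact, over an
# ARBITRARY exploration graph `Γ ≤ G` — the thin composition of p3-g4's input package `Skel.exists_stepIV_inputs_of_le` (`SkelStepIVInputs`)
# with `KNLevels.stepIV_in (G := Γ)`; generic twin of `BoxProdZ2KitStepIV.kit_hIV` with a purely GEOMETRIC route branch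

builds on p205010 (kernel theorem, internal audit signed; external expert review pending) — nothing in this file uses p205010.
Lane `prim-bschramm`, seat `prim-bschramm-p1` (gen 7; claim L5.7, rulings p3-g4 2026-08-20 19:11Z (2), 20:38Z (2), SHEAR-SCOPE §3.10.3);
helper file (`--supports stmt-CriticalPhenomena-4575 --as helper`).
**`Skel.kit_hIV_of_le`** — data: the Step-I input family at the running parameter `q` with margin `δ²` (`Skel.inputIndex/inputEvent`), two
scales `M < ℓ` in `S` with `msel ≤ M` on `Φ.types`, `Γ ≤ G`, a subbox weighting `Wt` of `Γ` on `D`, a pinning set `Spin ⊆ D`; at the contact's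
cube centre `c`: the cube `fatSeq c M ⊆ Spin`, the route prism `fatSeq c ℓ ⊆ D` with its inside `G`-edges `Γ`-edges, the face
`U = macroPiece c M (ψ M) g` on the `Γ`-inner boundary of the cube, and a macro piece of the route prism inside the target `T`.  Conclusion: the
`hIV` clause of `KNLevels.LHyp.stepV` for this contact (pinning set `Spin`, region `D`).  Consumers owe ROOM only (containments), never a
probability.  Far contacts (a face vertex in `T ∩ D`) are served by `Transplant.hIV_of_mem_face`.
[cite: KozmaNitzan2024, §4 Lemma 10 Step IV, pp. 19–21 ((21)–(25))] [cite: GrimmettPercolation1999, §7.2 (block arguments)]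
-/

noncomputable section

open MeasureTheory

namespace Summit.CriticalPhenomena.PercolationContinuityZ3.Theorems

namespace Transplant

namespace Skel

open Literature.Probability.Percolation Literature.Probability.LatticeModels SimpleGraph KNLevels KozmaNitzan
open Literature.Probability.Percolation.GM (HOct)
open scoped Classical

variable {V : Type} {G : SimpleGraph V} [G.LocallyFinite] (Φ : PlanarSkeletonConc G)

/-- **The Step-IV input `hIV` at a candidate contact, over an exploration graph `Γ ≤ G`.**  From the input family at `q` (margin `δ²`),
scales `M < ℓ` in `S` dominating `msel` on the base vertices, a subbox weighting of `Γ` on `D ⊇ Spin`, the cube `Λ_M(c) ⊆ Spin`, the route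
prism `Λ_ℓ(c) ⊆ D` with `Γ`-edges inside, the face `U = macroPiece c M (ψ M) g ⊆ ∂⁻_Γ Λ_M(c)`, and a macro piece of `Λ_ℓ(c)` inside `T`:
`P_{Wt}(∃ u ∈ U good) ≥ 1 − 3δ`. [cite: KozmaNitzan2024, §4 pp. 19–21 ((21)–(25))] -/
theorem kit_hIV_of_le [Countable V] {p : unitInterval} (hC : Φ.toPlanarSkeleton.CylSubcritical p) (msel : V → ℕ) {S : Finset ℕ}
    {q : unitInterval} {δ : ℝ} (hδ : 0 < δ)
    (hin : ∀ i ∈ inputIndex Φ S, 1 - δ ^ 2 < (bondPercolation G q).real (inputEvent Φ hC msel i))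
    {M ℓ : ℕ} (hM : M ∈ S) (hℓ : ℓ ∈ S) (hMℓ : M < ℓ) (hmsel : ∀ t ∈ Φ.types, msel t ≤ M)
    {Γ : SimpleGraph V} [Γ.LocallyFinite] (hΓ : Γ ≤ G) {Wt : Sym2 V → unitInterval} {D Spin T : Finset V} (hWD : IsSubbox Γ Wt q D)
    (hSD : Spin ⊆ D) {c : V} (hQS : fatSeq Φ hC c M ⊆ Spin) (hℓD : fatSeq Φ hC c ℓ ⊆ D)
    (hQΓ : ∀ u ∈ fatSeq Φ hC c ℓ, ∀ v ∈ fatSeq Φ hC c ℓ, G.Adj u v → Γ.Adj u v)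
    {U : Finset V} (g : HOct 2) (hUg : U = macroPiece Φ c M (fatRadius Φ hC M) g) (hUib : U ⊆ innerBoundary Γ (fatSeq Φ hC c M))
    (g' : HOct 2) (hT : macroPiece Φ c ℓ (fatRadius Φ hC ℓ) g' ⊆ T) :
    1 - 3 * δ ≤ (prodBernoulli Wt).real {ω | ∃ u ∈ U,
      1 - δ < (prodBernoulli (pinW Wt (wireSet (↑Spin : Set V)) ω)).real (⋃ t ∈ T, openConnIn (↑D : Set V) u t)} := by
  obtain ⟨t, ht, h1, h2, h3⟩ := exists_stepIV_inputs_of_le Φ hC msel hin hM hℓ hMℓ hΓ hWD hℓD hQΓ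
  obtain ⟨-, hdisj, h3'⟩ := h3 g'
  have hkn : fatSeq Φ hC c (msel t) ⊆ fatSeq Φ hC c M := fatSeq_monotone Φ hC c (hmsel t ht)
  have hfar : Disjoint (macroPiece Φ c ℓ (fatRadius Φ hC ℓ) g') (fatSeq Φ hC c M) := hdisj
  have h2' : 1 - δ ^ 2 < (prodBernoulli Wt).real (linkIn (↑(fatSeq Φ hC c M)) (fatSeq Φ hC c (msel t)) U) := by rw [hUg]; exact h2 g
  exact stepIV_in (G := Γ) (S := Spin) hWD hT hℓD (fatSeq Φ hC c) hkn hQS hUib hfar hδ (Rg := (↑D : Set V))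
    (Finset.coe_subset.2 (hQS.trans hSD)) (Finset.coe_subset.2 hℓD) h1 h2' h3'

end Skel

end Transplant

end Summit.CriticalPhenomena.PercolationContinuityZ3.Theorems

end
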